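import Mathlib
import HarnessLib
import Summits.ValiantsHypothesis.ValiantsHypothesis.Theorems.MonotoneRestorationOrbitRestorationQPRestorable
import Summits.ValiantsHypothesis.ValiantsHypothesis.Theorems.MonotoneRestorationQP.Negative.LoadBearing
import Literature.Computability.AlgebraicComplexity.DawarWilsenach2025Thm71

/-!
# Crux `OrbitRestorationQP` (stmt-ValiantsHypothesis-18293), rung `ΣΠΣ` (A_∞ = `stub_sigmaPiSigmaValue`):
# TERM-WISE REYNOLDS AVERAGING IS DEAD IN VALUE / ORBIT CURRENCY

Route MonotoneRestoration, line of record `depth-three-rung`.  The open residue A_∞ asks: every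
matrix-symmetric family with polynomial-size `ΣΠΣ` circuits, `f n = Σ_i T_i` with each `T_i` a product of
`≤ n^c + c` affine forms, is quasi-polynomially ORBIT-restorable (`QPOrbitRestorable`).  Since `f n` is
invariant under `Sym_n × Sym_n`, summing the renamings over the whole group gives the exact decomposition

  `(n!)² · f n = Σ_i 𝐑(T_i)`,  `𝐑(T) := Σ_{σ,τ ∈ Sym_n} T(x_{σ i, τ j})`  (`nsmul_eq_sum_reynoldsSum`),

in which every summand `𝐑(T_i)` is itself matrix-symmetric.  So the obvious TERM-WISE strategy for A_∞ —
orbit circuits are of unbounded size, hence the `(n!)²`-fold blow-up of the Reynolds sum costs nothing by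
itself — would be: restore each `𝐑(T_i)` and add (`qpOrbitRestorable_of_termwise`: this DOES give the
conclusion of A_∞ whenever the term averages are restorable with one constant).

This file certifies that the strategy is dead, unconditionally: already for the single `ΠΣ` term
`T = x_{00} x_{11} ⋯ x_{n-1,n-1}` (a product of `n` variables) the Reynolds sum is `n! · per_n`
(`reynoldsSum_prod_X_diag`), and the permanent is not quasi-polynomially orbit-restorable by
Dawar–Wilsenach 2025 Thm 7.1 (PROVED in the tree, `DawarWilsenach2025_thm71_holds`;
`not_qpOrbitRestorable_perPoly`).  Hence `reynolds_termwise_false`: there is NO constant `c` making the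
Reynolds sums of all products of `≤ n` affine forms `c`-restorable — any proof of A_∞ must use cancellation
BETWEEN the term averages `𝐑(T_i)` (as the landed bounded-fan-in sub-rungs A_k do, through the rank bound on
minimal vanishing sub-sums of `f − g·f`), never the terms one at a time.  This complements the crux
workfile's dead line `SupersededStubA` (exact term STABILITY is too strong); here even exact term
SYMMETRISATION is too weak a currency.

Honest framing: a negative helper (a dead-strategy certificate) for an OPEN stub; the crux, the rung and
`VP ≠ VNP` are not moved.
-/

noncomputable section

open MvPolynomial Equiv Filter
open Literature.Computability.AlgebraicComplexity

-- `Summit.ValiantsHypothesis.ValiantsHypothesis.…` is the tree's single-conjunct layout (Sub = Summit).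
set_option linter.dupNamespace false

namespace Summit.ValiantsHypothesis.ValiantsHypothesis.Theorems

namespace TermReynolds

open OrbitRestorationQPDepthThreeRung

variable {n : ℕ}

/-- The matrix renaming by a pair of permutations (rows by `σ`, columns by `τ`). [folklore] -/
theorem rename_pair_X (σ τ : Perm (Fin n)) (p : Fin n × Fin n) :
    rename (fun q : Fin n × Fin n => (σ q.1, τ q.2)) (X p : MvPolynomial (Fin n × Fin n) ℂ) =
      X (σ p.1, τ p.2) :=
  rename_X _ _

/-- **The Reynolds sum of the diagonal product is `n! · per_n`**:
`Σ_{σ,τ} Π_i x_{σ i, τ i} = n! · per_n`. [folklore] -/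
theorem reynoldsSum_prod_X_diag (n : ℕ) :
    ∑ σ : Perm (Fin n), ∑ τ : Perm (Fin n),
        rename (fun q : Fin n × Fin n => (σ q.1, τ q.2)) (∏ i : Fin n, (X (i, i) : MvPolynomial (Fin n × Fin n) ℂ)) =
      n.factorial • perPoly (Fin n) ℂ := by
  classical
  have hper : perPoly (Fin n) ℂ = ∑ π : Perm (Fin n), ∏ j : Fin n, X (π j, j) := by
    simp only [perPoly, Matrix.permanent, Matrix.mvPolynomialX_apply]
  have hterm : ∀ σ τ : Perm (Fin n),
      rename (fun q : Fin n × Fin n => (σ q.1, τ q.2)) (∏ i : Fin n, (X (i, i) : MvPolynomial (Fin n × Fin n) ℂ)) =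
        ∏ j : Fin n, X ((σ * τ⁻¹) j, j) := by
    intro σ τ
    rw [map_prod]
    simp only [rename_X]
    exact Fintype.prod_equiv τ _ _ fun i => by simp [Perm.mul_apply]
  simp only [hterm]
  rw [Finset.sum_comm]
  have hinner : ∀ τ : Perm (Fin n),
      ∑ σ : Perm (Fin n), ∏ j : Fin n, (X ((σ * τ⁻¹) j, j) : MvPolynomial (Fin n × Fin n) ℂ) =
        perPoly (Fin n) ℂ := by
    intro τ
    rw [hper]
    exact Fintype.sum_equiv (Equiv.mulRight τ⁻¹) _ _ fun σ => rfl
  simp only [hinner, Finset.sum_const, Finset.card_univ, Fintype.card_perm, Fintype.card_fin]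

/-- **The permanent is not quasi-polynomially orbit-restorable** (Dawar–Wilsenach 2025 Thm 7.1 in the
line's currency): for no constant `c` is `per_n` `c`-orbit-restorable at every level `n`.
[cite: DawarWilsenach2025, Thm. 7.1 (p. 18)] -/
theorem not_qpOrbitRestorable_perPoly (c : ℕ) : ¬ ∀ n : ℕ, QPOrbitRestorable c n (perPoly (Fin n) ℂ) := by
  intro h
  classical
  unfold QPOrbitRestorable at h
  choose G inst C hCsymm hCeval hCorb using h
  obtain ⟨ε, hε, hfreq⟩ := @DawarWilsenach2025_thm71_holds ℂ _ _ G inst C hCsymm hCeval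
  obtain ⟨n₀, key⟩ := MonotoneRestorationQP.Negative.polylog_pow_lt_linear c hε
  obtain ⟨n, hle, hn⟩ := (hfreq.and_eventually (eventually_ge_atTop n₀)).exists
  have horb : (((C n).orbitSize (Equiv.Perm (Fin n)) : ℕ) : ℝ) ≤
      (2 : ℝ) ^ (((Nat.log 2 n + c) ^ c : ℕ) : ℝ) := by
    rw [Real.rpow_natCast]
    exact_mod_cast hCorb n
  have hlt : (2 : ℝ) ^ (((Nat.log 2 n + c) ^ c : ℕ) : ℝ) < (2 : ℝ) ^ (ε * n) := by
    apply (Real.rpow_lt_rpow_left_iff one_lt_two).2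
    have := key n hn
    push_cast at this ⊢
    exact this
  exact absurd (hle.trans horb) (not_le.mpr hlt)

/-- `n! · per_n` is not restorable either (divide by `n!`). [cite: DawarWilsenach2025, Thm. 7.1 (p. 18)] -/
theorem not_qpOrbitRestorable_factorial_smul_perPoly (c : ℕ) :
    ¬ ∀ n : ℕ, QPOrbitRestorable c n (n.factorial • perPoly (Fin n) ℂ) := by
  intro h
  refine not_qpOrbitRestorable_perPoly (c + 3) fun n => ?_
  have h1 := ValueOrbit.qpOrbitRestorable_smul ((n.factorial : ℂ)⁻¹) (h n)
  have hne : (n.factorial : ℂ) ≠ 0 := by exact_mod_cast n.factorial_ne_zero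
  rwa [nsmul_eq_mul, ← mul_assoc, ← map_natCast (C : ℂ →+* MvPolynomial (Fin n × Fin n) ℂ), ← map_mul,
    inv_mul_cancel₀ hne, map_one, one_mul] at h1

/-- **TERM-WISE REYNOLDS AVERAGING IS DEAD**: it is NOT the case that the Reynolds sums
`Σ_{σ,τ} (σ,τ)·Π L` of all product terms of at most `n` affine forms are orbit-restorable with one
constant — the diagonal product `Π_i x_{ii}` (whose Reynolds sum is `n! · per_n`) is a witness.
[cite: DawarWilsenach2025, Thm. 7.1 (p. 18)] -/
theorem reynolds_termwise_false :
    ¬ ∀ L : (n : ℕ) → Multiset (MvPolynomial (Fin n × Fin n) ℂ),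
        (∀ n, ∀ ℓ ∈ L n, ℓ.totalDegree ≤ 1) → (∀ n, Multiset.card (L n) ≤ n) →
        ∃ c : ℕ, ∀ n : ℕ, QPOrbitRestorable c n
          (∑ σ : Perm (Fin n), ∑ τ : Perm (Fin n),
            rename (fun q : Fin n × Fin n => (σ q.1, τ q.2)) (L n).prod) := by
  intro h
  classical
  let L : (n : ℕ) → Multiset (MvPolynomial (Fin n × Fin n) ℂ) :=
    fun n => (Finset.univ : Finset (Fin n)).val.map fun i => X (i, i)
  have hdeg : ∀ n, ∀ ℓ ∈ L n, ℓ.totalDegree ≤ 1 := by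
    intro n ℓ hℓ
    obtain ⟨i, -, rfl⟩ := Multiset.mem_map.1 hℓ
    exact (totalDegree_X (R := ℂ) (i, i)).le
  have hcard : ∀ n, Multiset.card (L n) ≤ n := by
    intro n
    simp [L]
  have hprod : ∀ n, (L n).prod = ∏ i : Fin n, (X (i, i) : MvPolynomial (Fin n × Fin n) ℂ) := fun n => rfl
  obtain ⟨c, hc⟩ := h L hdeg hcard
  refine not_qpOrbitRestorable_factorial_smul_perPoly c fun n => ?_
  have := hc n
  rwa [hprod, reynoldsSum_prod_X_diag] at this

/-! ### Why the strategy was on path: the exact Reynolds decomposition of a matrix-symmetric sum -/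

/-- **Reynolds decomposition**: if `f` is matrix-symmetric and `f = Σ_{i ∈ s} T i`, then
`(n!)² · f = Σ_{i ∈ s} Σ_{σ,τ} (σ,τ)·(T i)`. [folklore] -/
theorem nsmul_eq_sum_reynoldsSum {ι : Type*} (s : Finset ι) (T : ι → MvPolynomial (Fin n × Fin n) ℂ)
    (f : MvPolynomial (Fin n × Fin n) ℂ)
    (hf : ∀ σ τ : Perm (Fin n), rename (fun q : Fin n × Fin n => (σ q.1, τ q.2)) f = f)
    (hT : f = ∑ i ∈ s, T i) :
    (n.factorial ^ 2) • f =
      ∑ i ∈ s, ∑ σ : Perm (Fin n), ∑ τ : Perm (Fin n),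
        rename (fun q : Fin n × Fin n => (σ q.1, τ q.2)) (T i) := by
  classical
  calc (n.factorial ^ 2) • f
      = ∑ σ : Perm (Fin n), ∑ τ : Perm (Fin n), rename (fun q : Fin n × Fin n => (σ q.1, τ q.2)) f := by
        simp only [hf, Finset.sum_const, Finset.card_univ, Fintype.card_perm, Fintype.card_fin, smul_smul, sq]
    _ = ∑ σ : Perm (Fin n), ∑ τ : Perm (Fin n), ∑ i ∈ s,
          rename (fun q : Fin n × Fin n => (σ q.1, τ q.2)) (T i) := by
        simp only [hT, map_sum]
    _ = ∑ σ : Perm (Fin n), ∑ i ∈ s, ∑ τ : Perm (Fin n),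
          rename (fun q : Fin n × Fin n => (σ q.1, τ q.2)) (T i) :=
        Finset.sum_congr rfl fun σ _ => Finset.sum_comm
    _ = ∑ i ∈ s, ∑ σ : Perm (Fin n), ∑ τ : Perm (Fin n),
          rename (fun q : Fin n × Fin n => (σ q.1, τ q.2)) (T i) := Finset.sum_comm

/-- Each Reynolds sum is matrix-symmetric. [folklore] -/
theorem rename_pair_reynoldsSum (T : MvPolynomial (Fin n × Fin n) ℂ) (σ₀ τ₀ : Perm (Fin n)) :
    rename (fun q : Fin n × Fin n => (σ₀ q.1, τ₀ q.2))
        (∑ σ : Perm (Fin n), ∑ τ : Perm (Fin n), rename (fun q : Fin n × Fin n => (σ q.1, τ q.2)) T) =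
      ∑ σ : Perm (Fin n), ∑ τ : Perm (Fin n), rename (fun q : Fin n × Fin n => (σ q.1, τ q.2)) T := by
  classical
  simp only [map_sum, rename_rename]
  have hcomp : ∀ σ τ : Perm (Fin n),
      ((fun q : Fin n × Fin n => (σ₀ q.1, τ₀ q.2)) ∘ fun q : Fin n × Fin n => (σ q.1, τ q.2)) =
        fun q : Fin n × Fin n => ((σ₀ * σ) q.1, (τ₀ * τ) q.2) := by
    intro σ τ; funext q; simp [Perm.mul_apply]
  simp only [hcomp]
  refine Fintype.sum_equiv (Equiv.mulLeft σ₀) _ _ fun σ => ?_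
  exact Fintype.sum_equiv (Equiv.mulLeft τ₀) _ _ fun τ => rfl

/-- **The term-wise strategy WOULD close A_∞-type goals**: if `f` is matrix-symmetric, `f = Σ_{j<m} T j`, and
every Reynolds sum `Σ_{σ,τ} (σ,τ)·(T j)` is `c`-orbit-restorable (`c ≥ 5`), then `f` is
`(c + 3m + 3)`-orbit-restorable (restore the term averages, add, divide by `(n!)²`). [folklore] -/
theorem qpOrbitRestorable_of_termwise {c m : ℕ} (hc : 5 ≤ c) (T : Fin m → MvPolynomial (Fin n × Fin n) ℂ)
    (f : MvPolynomial (Fin n × Fin n) ℂ)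
    (hf : ∀ σ τ : Perm (Fin n), rename (fun q : Fin n × Fin n => (σ q.1, τ q.2)) f = f)
    (hT : f = ∑ j, T j)
    (hR : ∀ j, QPOrbitRestorable c n
      (∑ σ : Perm (Fin n), ∑ τ : Perm (Fin n), rename (fun q : Fin n × Fin n => (σ q.1, τ q.2)) (T j))) :
    QPOrbitRestorable (c + 3 * m + 3) n f := by
  have hsum := Restorable.qpOrbitRestorable_sum hc m _ hR
  rw [← nsmul_eq_sum_reynoldsSum Finset.univ T f hf hT] at hsum
  have h1 := ValueOrbit.qpOrbitRestorable_smul (((n.factorial : ℂ) ^ 2)⁻¹) hsum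
  have hne : ((n.factorial : ℂ) ^ 2) ≠ 0 := pow_ne_zero _ (by exact_mod_cast n.factorial_ne_zero)
  rwa [nsmul_eq_mul, ← mul_assoc, Nat.cast_pow, ← map_natCast (C : ℂ →+* MvPolynomial (Fin n × Fin n) ℂ),
    ← map_pow, ← map_mul, inv_mul_cancel₀ hne, map_one, one_mul] at h1

end TermReynolds

end Summit.ValiantsHypothesis.ValiantsHypothesis.Theorems

end
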